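import Summits.PneNP.PneNP.Theorems.SymmetryBudgetNoHiddenOrderBranchSumDefs

/-!
# Reachable sets and ATOMS of the switching graph — definitions (per-path canoniser, `NoHiddenOrder`, stmt-PneNP-14781)

Route `PneNP/SymmetryBudget`; memo `PER-PATH.md` §1/§11. In the W-relative vocabulary of `…BranchSumDefs` (`cellOf`,
`swGraph G W c`: the switching-equivalent graph of the partition of `W` by `c`, B. Laubner, PhD thesis HU Berlin 2011,
Def. 3.3.2), two plain finite iterations (no choice) used by the components-only Corneil–Goldberg process:

* `swExpand G B c S` / `swReach G B c v` — expansion by switching neighbours inside `B`, iterated `|B|` times from `{v} ∩ B`: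
  the vertices of `B` reachable from `v` through `B` (`swReach_subset`, `self_mem_swReach`, `swReach_closed`);
* `atom G W c v` — iterate `B ↦ swReach G B c v` from `W` to its fixed point (`swReach_atom`), reached within `|W| + 1`
  rounds because the blocks decrease (`exists_atomStep_fixed`); switching thresholds are recomputed relative to the current
  block at every round, exactly as along the AND-steps of the recursion tree. `atom_subset`, `self_mem_atom`.

The theorems (sections, connectivity of the atom's own switching graph, homogeneity of dropped vertices, inherited
equitability) are in `SymmetryBudgetNoHiddenOrderPerPathAtoms.lean`.
-/

-- `Summit.PneNP.PneNP.…` duplicates `PneNP` BY DESIGN (single-problem summit, D-0017 layout).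
set_option linter.dupNamespace false

namespace Summit.PneNP.PneNP.Theorems

open Finset

namespace BranchSum

variable {V : Type*} [DecidableEq V] (G : SimpleGraph V) [DecidableRel G.Adj]

/-! ### Reachable sets in the switching graph of a block -/

/-- One expansion step inside `B`: add the switching neighbours (w.r.t. the partition of `B`) of `S` that lie in `B`. -/
def swExpand (B : Finset V) (c : V → ℕ) (S : Finset V) : Finset V :=
  S ∪ B.filter fun b => ∃ a ∈ S, (swGraph G B c).Adj a b

/-- `swReach G B c v`: iterate the expansion `|B|` times from `{v} ∩ B`. -/
def swReach (B : Finset V) (c : V → ℕ) (v : V) : Finset V :=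
  (swExpand G B c)^[B.card] ({v} ∩ B)

variable {G}

/-- The expansion contains the set. -/
theorem subset_swExpand (B : Finset V) (c : V → ℕ) (S : Finset V) : S ⊆ swExpand G B c S :=
  subset_union_left

/-- The expansion of a subset of `B` stays inside `B`. -/
theorem swExpand_subset {B : Finset V} (c : V → ℕ) {S : Finset V} (hS : S ⊆ B) : swExpand G B c S ⊆ B :=
  union_subset hS (filter_subset _ _)

/-- The expansion is monotone. -/
theorem swExpand_mono (B : Finset V) (c : V → ℕ) {S T : Finset V} (h : S ⊆ T) : swExpand G B c S ⊆ swExpand G B c T := by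
  intro x hx
  rw [swExpand, mem_union] at hx ⊢
  rcases hx with hx | hx
  · exact Or.inl (h hx)
  · rw [mem_filter] at hx ⊢
    obtain ⟨a, ha, hab⟩ := hx.2
    exact Or.inr ⟨hx.1, a, h ha, hab⟩

/-- All iterates of a subset of `B` stay inside `B`. -/
theorem iterate_swExpand_subset {B : Finset V} (c : V → ℕ) {S : Finset V} (hS : S ⊆ B) (n : ℕ) :
    (swExpand G B c)^[n] S ⊆ B := by
  induction n with
  | zero => exact hS
  | succ n ih => rw [Function.iterate_succ_apply']; exact swExpand_subset c ih

/-- The iterates contain the start. -/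
theorem subset_iterate_swExpand (B : Finset V) (c : V → ℕ) (S : Finset V) (n : ℕ) : S ⊆ (swExpand G B c)^[n] S := by
  induction n with
  | zero => exact Subset.rfl
  | succ n ih => rw [Function.iterate_succ_apply']; exact ih.trans (subset_swExpand _ _ _)

/-- The iterates grow; once two consecutive ones agree they are stationary. -/
theorem iterate_swExpand_stable {B : Finset V} (c : V → ℕ) (S : Finset V) {n : ℕ}
    (h : (swExpand G B c)^[n + 1] S = (swExpand G B c)^[n] S) (m : ℕ) (hm : n ≤ m) :
    (swExpand G B c)^[m] S = (swExpand G B c)^[n] S := by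
  induction hm with
  | refl => rfl
  | step _ ih => rw [Function.iterate_succ_apply', ih, ← Function.iterate_succ_apply' (swExpand G B c) n S, h]

/-- After `|B|` steps the expansion from a subset of `B` is closed. -/
theorem swExpand_iterate_card {B : Finset V} (c : V → ℕ) {S : Finset V} (hS : S ⊆ B) :
    swExpand G B c ((swExpand G B c)^[B.card] S) = (swExpand G B c)^[B.card] S := by
  -- if not, all `|B| + 2` iterates `0, …, |B|+1` would be distinct subsets of `B` of strictly increasing size ≥ |S|… ≤ |B|
  by_contra hne
  have hstrict : ∀ n ≤ B.card, ((swExpand G B c)^[n] S).card < ((swExpand G B c)^[n + 1] S).card := by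
    intro n hn
    refine card_lt_card ⟨by rw [Function.iterate_succ_apply']; exact subset_swExpand _ _ _, fun hsub => hne ?_⟩
    have heq : (swExpand G B c)^[n + 1] S = (swExpand G B c)^[n] S :=
      Subset.antisymm hsub (by rw [Function.iterate_succ_apply']; exact subset_swExpand _ _ _)
    have h1 := iterate_swExpand_stable c S heq (B.card + 1) (by omega)
    have h2 := iterate_swExpand_stable c S heq B.card hn
    rw [Function.iterate_succ_apply'] at h1
    rw [h2]; rw [h2] at h1; exact h1
  have hgrow : ∀ n ≤ B.card + 1, n ≤ ((swExpand G B c)^[n] S).card := by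
    intro n
    induction n with
    | zero => intro _; exact Nat.zero_le _
    | succ n ih => intro hn; have := hstrict n (by omega); have := ih (by omega); omega
  have := hgrow (B.card + 1) le_rfl
  have := card_le_card (iterate_swExpand_subset (G := G) c hS (B.card + 1))
  omega

/-- `swReach ⊆ B`. -/
theorem swReach_subset (B : Finset V) (c : V → ℕ) (v : V) : swReach G B c v ⊆ B :=
  iterate_swExpand_subset c inter_subset_right _

/-- `v ∈ swReach G B c v` for `v ∈ B`. -/
theorem self_mem_swReach {B : Finset V} (c : V → ℕ) {v : V} (hv : v ∈ B) : v ∈ swReach G B c v :=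
  subset_iterate_swExpand B c _ _ (mem_inter.2 ⟨mem_singleton_self v, hv⟩)

/-- `swReach` is closed under switching adjacency (w.r.t. the partition of `B`) inside `B`. -/
theorem swReach_closed {B : Finset V} (c : V → ℕ) (v : V) {a : V} (ha : a ∈ swReach G B c v) {b : V} (hb : b ∈ B)
    (hab : (swGraph G B c).Adj a b) : b ∈ swReach G B c v := by
  have h := swExpand_iterate_card (G := G) c (inter_subset_right (s₁ := ({v} : Finset V)) (s₂ := B))
  unfold swReach
  rw [← h, swExpand, mem_union]
  exact Or.inr (mem_filter.2 ⟨hb, a, ha, hab⟩)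

/-! ### The atom of a vertex: iterate `B ↦ swReach G B c v` to its fixed point -/

variable (G)

/-- `atom G W c v`: the fixed point of `B ↦ swReach G B c v` started at `W` (reached within `|W| + 1` rounds; switching
thresholds are recomputed relative to the current block at every round). -/
def atom (W : Finset V) (c : V → ℕ) (v : V) : Finset V :=
  (fun B => swReach G B c v)^[W.card + 1] W

variable {G}

/-- All rounds stay inside `W`. -/
theorem iterate_atomStep_subset (W : Finset V) (c : V → ℕ) (v : V) (n : ℕ) :
    (fun B => swReach G B c v)^[n] W ⊆ W := by
  induction n with
  | zero => exact Subset.rfl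
  | succ n ih => rw [Function.iterate_succ_apply']; exact (swReach_subset _ c v).trans ih

/-- The rounds decrease. -/
theorem iterate_atomStep_succ_subset (W : Finset V) (c : V → ℕ) (v : V) (n : ℕ) :
    (fun B => swReach G B c v)^[n + 1] W ⊆ (fun B => swReach G B c v)^[n] W := by
  rw [Function.iterate_succ_apply']; exact swReach_subset _ c v

/-- `v` survives every round. -/
theorem self_mem_iterate_atomStep {W : Finset V} (c : V → ℕ) {v : V} (hv : v ∈ W) (n : ℕ) :
    v ∈ (fun B => swReach G B c v)^[n] W := by
  induction n with
  | zero => exact hv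
  | succ n ih => rw [Function.iterate_succ_apply']; exact self_mem_swReach c ih

/-- Once two consecutive rounds agree, the iteration is stationary. -/
theorem iterate_atomStep_stable (W : Finset V) (c : V → ℕ) (v : V) {n : ℕ}
    (h : (fun B => swReach G B c v)^[n + 1] W = (fun B => swReach G B c v)^[n] W) (m : ℕ) (hm : n ≤ m) :
    (fun B => swReach G B c v)^[m] W = (fun B => swReach G B c v)^[n] W := by
  induction hm with
  | refl => rfl
  | step _ ih => rw [Function.iterate_succ_apply', ih, ← Function.iterate_succ_apply' (fun B => swReach G B c v) n W, h]

/-- The decreasing iteration is stationary from some round `n ≤ |W|` on. -/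
theorem exists_atomStep_fixed (W : Finset V) (c : V → ℕ) (v : V) :
    ∃ n ≤ W.card, (fun B => swReach G B c v)^[n + 1] W = (fun B => swReach G B c v)^[n] W := by
  by_contra h
  push Not at h
  -- then the sizes strictly decrease for `|W| + 1` rounds
  have hstrict : ∀ n ≤ W.card, ((fun B => swReach G B c v)^[n + 1] W).card < ((fun B => swReach G B c v)^[n] W).card :=
    fun n hn => card_lt_card ⟨iterate_atomStep_succ_subset W c v n, fun hsub =>
      h n hn (Subset.antisymm (iterate_atomStep_succ_subset W c v n) hsub)⟩
  have hdec : ∀ n ≤ W.card + 1, ((fun B => swReach G B c v)^[n] W).card + n ≤ W.card := by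
    intro n
    induction n with
    | zero => intro _; simp
    | succ n ih => intro hn; have := hstrict n (by omega); have := ih (by omega); omega
  have := hdec (W.card + 1) le_rfl
  omega

/-- `atom` is a fixed point of the step. -/
theorem swReach_atom (W : Finset V) (c : V → ℕ) (v : V) : swReach G (atom G W c v) c v = atom G W c v := by
  obtain ⟨n, hn, hfix⟩ := exists_atomStep_fixed (G := G) W c v
  have hst := iterate_atomStep_stable W c v hfix
  unfold atom
  rw [hst (W.card + 1) (by omega), ← Function.iterate_succ_apply' (fun B => swReach G B c v) n W, hfix]

/-- `atom ⊆ W`. -/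
theorem atom_subset (W : Finset V) (c : V → ℕ) (v : V) : atom G W c v ⊆ W := iterate_atomStep_subset W c v _

/-- `v ∈ atom G W c v` for `v ∈ W`. -/
theorem self_mem_atom {W : Finset V} (c : V → ℕ) {v : V} (hv : v ∈ W) : v ∈ atom G W c v :=
  self_mem_iterate_atomStep c hv _


end BranchSum

end Summit.PneNP.PneNP.Theorems
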